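import Summits.QuantumFields.BalabanUV.T4Continuum.Support.NE9KernelGeometry
import Literature.MathematicalPhysics.QuantumFieldTheory.Balaban1983to89.B12Cubes436

/-!
# NE9KernelGeometryLattice — the ONE geometric letter of `NE9KernelGeometry` («Δ_X ≤ cM·(d(X) + 1)») DISCHARGED on the cell's
# lattice carriers: for a window localization domain X of M-cubes of ℤ^d the sites of X have sup-extent ≤ 3·M·d·(treeLen X + 1),
# so the kernel species' geometry binder (G) holds there with δ₁ := min (δ₀/2) (w/(6·M·d)), w₀ := w and NO displayed letter
# (cell `pub-balaban`, T4-DAG §2 node U3 / §6 NE9; swarm unit b2b-balaban-t4-ne9-formalise-leaf-09, generation 6; own-initiative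
# micro-item «(G)-REC», journal CLAIM l.11285 — sequel of «(G)-GEOM» p214491)

HONEST FRAMING (T4-DAG PAGE 1).  Rung (B)+1 of the FINITE-VOLUME T⁴ programme — NOT infinite volume, NOT a mass gap, NOT the
Clay problem.  NE9 (`T4OutputRate.NE9` ∧ `FadingMemory`) is a cell NEW ESTIMATE, NOT PRINTED, NOT discharged here; spine 0/9;
0/18 skeleton leaves instantiated on Bałaban's objects (O-NE9-1).  HONEST DEPENDENCY (cell line, verbatim): continuum YM on T⁴
⇐ BetaPertH ∧ nine spine estimates (0/9 proved); BetaPertH ⇐ (D1) ∧ (D4) ∧ CAP+tail; G-an2-4 gates asym, D1 and NE2/3/4.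
[I] = [Balaban1987RG1] (CMP **109**) is quoted for TYPES only (ABSOLUTE RULE: nothing printed in the audited series is asserted).

WHAT THIS FILE IS.  `NE9KernelGeometry` (p214491) reduced the kernel species' displayed geometry binder (G) of
`KerData.Admissible` ([I] p. 286) to the triangle inequality plus ONE geometric letter: the point set of the source domain X
has extent `Δ_X ≤ cM·(d(X) + 1)`.  On the cell's LATTICE carriers that letter is already kernel: for a window localization
domain `X : Finset (Pt d)` of M-cubes of ℤ^d (`B13ScaleTransfer.FaceConnected`, pv11) with the linear size `TreeLength.treeLen X`
(pv22; print's d_j read in the universal cover, DIVERGENCE D-pv22.1), the cell's `B12Decay510Lattice.l1_sub_le_treeLen_sites`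
(b03) gives `|p − q|₁ ≤ M·d·(treeLen X + 3)` for all sites p, q of the cubes of X, and `B12Cubes436.dist_le_l1` compares the sup
metric of ℤ^d (the lattice model's `ρd`, as in (w24)'s `NE9LatticeExpSums`) with |·|₁.  Hence (§1) `extent_sites_le`: sup-extent
`≤ M·d·(treeLen X + 3) ≤ 3·M·d·(treeLen X + 1)`, and (§2) **`geom_lattice`**: (G) for the site set `{p | cubeOf M p ∈ X}` with
`dX X p := infDist p (sites of X)`, `ρd := dist`, base point any site of X, `d := treeLen X`, and the EXPLICIT letters
`δ₁ := min (δ₀/2) (w/(2·(3·M·d)))`, `w₀ := w` — `NE9KernelGeometry.geom_letters` at `cM := 3·M·d`.  REMARK (O1-side): Bałaban's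
carrier is the TORUS; there the same bound is the cell's `B12Decay510Torus.pl1_sub_le_torusTreeLen_sites` (periodic ℓ¹ distance
≤ M·d·(torusTreeLen X̄ + 3)); the periodic ℓ¹ distance is not a Mathlib `dist` on `TPt`, so the torus reading of (G) is a
one-line transcription for whoever fixes the kernel species' point type (O-NE9-1), not done here.
DISGUISE TEST: lattice geometry of one source domain; no history, no coupling; not NE9.

References (TYPES only): [Balaban1987RG1] T. Bałaban, CMP **109** (1987) 249–301, p. 257 (π_j, d_j(X)), (4.22) p. 286 («δ₁ = O(M⁻¹)»).
Summits-side NEW work (LEAN PLACEMENT RULE); imports `NE9KernelGeometry` (p214491) and the Literature module `B12Cubes436` (b03;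
transitively `B12Decay510Lattice`, `TreeLength`, `B13ScaleTransfer`) BY NAME; modifies nothing; 0 sorry; 0 def.
Value = one displayed letter of species (b) discharged on the lattice model, NOT summit progress.
-/

noncomputable section

namespace Summit.QuantumFields.BalabanUV.T4Continuum.NE9KernelGeometryLattice

open Metric Set
open Literature.MathematicalPhysics.QuantumFieldTheory.Balaban1983to89
open Literature.MathematicalPhysics.QuantumFieldTheory.Balaban1983to89.B13ScaleTransfer (Pt FaceConnected)
open Literature.MathematicalPhysics.QuantumFieldTheory.Balaban1983to89.TreeLength (treeLen treeLen_nonneg)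
open Literature.MathematicalPhysics.QuantumFieldTheory.Balaban1983to89.B12Decay510Lattice (cubeOf l1_sub_le_treeLen_sites)
open Literature.MathematicalPhysics.QuantumFieldTheory.Balaban1983to89.B12Cubes436 (dist_le_l1)
open Summit.QuantumFields.BalabanUV.T4Continuum.NE9KernelGeometry (geom_letters)

variable {d M : ℕ}

/-! ## §1 The extent of the sites of a window localization domain -/

/-- **SITE-LEVEL SUP-EXTENT OF A WINDOW LOCALIZATION DOMAIN**: two sites of the M-cubes of a face-connected family `X` of cubes of
ℤ^d are within sup-distance `M·d·(treeLen X + 3)` (the cell's ℓ¹ bound `l1_sub_le_treeLen_sites` and `dist ≤ |·|₁`).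
[cite: Balaban1987RG1, p.257] -/
theorem extent_sites_le (hM : 0 < M) {X : Finset (Pt d)} (hX : X.Nonempty) (hc : FaceConnected X) {p q : Pt d}
    (hp : cubeOf M p ∈ X) (hq : cubeOf M q ∈ X) : dist p q ≤ (M : ℝ) * d * (treeLen X + 3) :=
  (dist_le_l1 p q).trans (l1_sub_le_treeLen_sites hM hX hc hp hq)

/-- The same extent in the shape of `NE9KernelGeometry`'s diameter letter: `≤ cM·(treeLen X + 1)` with `cM := 3·M·d`
(`treeLen X ≥ 0`). [folklore] -/
theorem extent_sites_le_letter (hM : 0 < M) {X : Finset (Pt d)} (hX : X.Nonempty) (hc : FaceConnected X) {p q : Pt d}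
    (hp : cubeOf M p ∈ X) (hq : cubeOf M q ∈ X) : dist p q ≤ 3 * (M : ℝ) * d * (treeLen X + 1) := by
  have h := extent_sites_le hM hX hc hp hq
  have ht : 0 ≤ treeLen X := treeLen_nonneg X
  have hMd : 0 ≤ (M : ℝ) * d := by positivity
  nlinarith

/-! ## §2 (G) on the lattice carriers, letters explicit, no displayed geometric input -/

/-- **(G) FOR THE KERNEL SPECIES ON THE LATTICE CARRIERS OF RECORD** (window localization domains of M-cubes of ℤ^d, sup metric,
linear size `treeLen`): for a face-connected nonempty `X`, a base site `x₀` of X, decay letters `δ₀ ≥ 0`, `w ≥ 0`, and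
`0 < M`, `0 < d`, the binder (G) of `KerData.Admissible` holds for ALL points `p, q` of ℤ^d with
`dX X p := infDist p {sites of X}`, `ρd := dist`, `d(X) := treeLen X`, **`δ₁ := min (δ₀/2) (w/(2·(3·M·d)))`** and **`w₀ := w`**:
`δ₁·dist x₀ p + δ₁·dist p q ≤ δ₀·(infDist p S + infDist q S) + w·treeLen X + w` — `NE9KernelGeometry.geom_letters` at
`cM := 3·M·d` fed with §1.  Print: *"δ₁ = O(M⁻¹), because of the factor with κd_j(X)"* ([I] p. 286; here δ₁ ≤ w/(6Md), w ↔ ⅔κ).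
[cite: Balaban1987RG1, (4.22) p.286] -/
theorem geom_lattice (hM : 0 < M) (hd : 0 < d) {X : Finset (Pt d)} (hX : X.Nonempty) (hc : FaceConnected X) {x₀ : Pt d}
    (hx₀ : cubeOf M x₀ ∈ X) {δ₀ w : ℝ} (hδ₀ : 0 ≤ δ₀) (hw : 0 ≤ w) (p q : Pt d) :
    min (δ₀ / 2) (w / (2 * (3 * (M : ℝ) * d))) * dist x₀ p + min (δ₀ / 2) (w / (2 * (3 * (M : ℝ) * d))) * dist p q ≤
      δ₀ * (infDist p {u : Pt d | cubeOf M u ∈ X} + infDist q {u : Pt d | cubeOf M u ∈ X}) + w * treeLen X + w :=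
  geom_letters (S := {u : Pt d | cubeOf M u ∈ X}) (Δ := (M : ℝ) * d * (treeLen X + 3)) hx₀
    (fun _ hu _ hv => extent_sites_le hM hX hc hu hv) hδ₀ hw (by positivity) (treeLen_nonneg X)
    (by
      have ht : 0 ≤ treeLen X := treeLen_nonneg X
      have hMd : 0 ≤ (M : ℝ) * d := by positivity
      nlinarith)
    p q

/-- The decay letter is a genuine decay and of print's size: `0 < δ₁ ≤ w/(6·M·d)` for `0 < δ₀`, `0 < w` («δ₁ = O(M⁻¹)»).
[cite: Balaban1987RG1, (4.22) p.286] -/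
theorem delta1_lattice_pos_le (hM : 0 < M) (hd : 0 < d) {δ₀ w : ℝ} (hδ₀ : 0 < δ₀) (hw : 0 < w) :
    0 < min (δ₀ / 2) (w / (2 * (3 * (M : ℝ) * d))) ∧
      min (δ₀ / 2) (w / (2 * (3 * (M : ℝ) * d))) ≤ w / (6 * (M : ℝ) * d) := by
  have hMd : 0 < (M : ℝ) * d := by positivity
  refine ⟨lt_min (by linarith) (div_pos hw (by positivity)), (min_le_right _ _).trans (le_of_eq ?_)⟩
  ring

/-! ## §3 (v1.1, append-only) The SUP-SHARP letter: δ₁ := min (δ₀/2) (w/(6M)), no factor 1/d, no `0 < d`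

The lattice model's `dist` on `Fin d → ℤ` is the SUP metric (cell convention D-pv22.1), and b03's `B12Decay510Lattice.dist_le_treeLen_sites`
bounds the site extent of a window localization domain DIRECTLY in it: `dist p q ≤ M·(treeLen X + 3)` — without the factor `d` that the ℓ¹
route of §1 (`dist ≤ |·|₁ ≤ M·d·(treeLen X + 3)`) carries.  Feeding this extent into `NE9KernelGeometry.geom_letters` at `cM := 3·M`
gives (G) with **`δ₁ := min (δ₀/2) (w/(2·(3·M)))`**, i.e. `δ₁ ≤ w/(6M)` — print's *"δ₁ = O(M⁻¹)"* ([I] p. 286) on the nose — and drops the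
hypothesis `0 < d` (answers INFO I2 of the cross-read C-ne7ideward-12, journal l.11518; swarm unit b2b-balaban-t4-ne9-formalise-leaf-09,
generation 7).  §§1–2 are unchanged; the ℓ¹ letters remain the ones matching the TORUS reading (`NE9KernelGeometryTorus`, periodic ℓ¹). -/

/-- The sup-extent in the shape of the diameter letter, d-FREE: `dist p q ≤ 3·M·(treeLen X + 1)` for sites of the cubes of a face-connected
nonempty `X` (b03's `dist_le_treeLen_sites`: `≤ M·(treeLen X + 3)`, and `treeLen X ≥ 0`). [folklore] -/
theorem extent_sites_le_letter_sup (hM : 0 < M) {X : Finset (Pt d)} (hX : X.Nonempty) (hc : FaceConnected X) {p q : Pt d}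
    (hp : cubeOf M p ∈ X) (hq : cubeOf M q ∈ X) : dist p q ≤ 3 * (M : ℝ) * (treeLen X + 1) := by
  have h := B12Decay510Lattice.dist_le_treeLen_sites hM hX hc hp hq
  have ht : 0 ≤ treeLen X := treeLen_nonneg X
  have hM0 : 0 ≤ (M : ℝ) := Nat.cast_nonneg M
  nlinarith [mul_nonneg hM0 ht]

/-- **(G) ON THE LATTICE CARRIERS WITH THE SUP-SHARP LETTER** (d-free): for a face-connected nonempty family `X` of M-cubes of ℤ^d, a
base site `x₀`, decay letters `δ₀ ≥ 0`, `w ≥ 0` and `0 < M`, the binder (G) of `KerData.Admissible` holds for ALL points `p, q` with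
`dX X p := infDist p {sites of X}`, `ρd := dist` (sup), `d(X) := treeLen X`, **`δ₁ := min (δ₀/2) (w/(2·(3·M)))`** and **`w₀ := w`**:
`δ₁·dist x₀ p + δ₁·dist p q ≤ δ₀·(infDist p S + infDist q S) + w·treeLen X + w` — `NE9KernelGeometry.geom_letters` at `cM := 3·M` fed with
b03's sup-diameter `dist_le_treeLen_sites`.  Print: *"δ₁ = O(M⁻¹), because of the factor with κd_j(X)"* ([I] p. 286; here `δ₁ ≤ w/(6M)`).
[cite: Balaban1987RG1, (4.22) p.286] -/
theorem geom_lattice_sup (hM : 0 < M) {X : Finset (Pt d)} (hX : X.Nonempty) (hc : FaceConnected X) {x₀ : Pt d}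
    (hx₀ : cubeOf M x₀ ∈ X) {δ₀ w : ℝ} (hδ₀ : 0 ≤ δ₀) (hw : 0 ≤ w) (p q : Pt d) :
    min (δ₀ / 2) (w / (2 * (3 * (M : ℝ)))) * dist x₀ p + min (δ₀ / 2) (w / (2 * (3 * (M : ℝ)))) * dist p q ≤
      δ₀ * (infDist p {u : Pt d | cubeOf M u ∈ X} + infDist q {u : Pt d | cubeOf M u ∈ X}) + w * treeLen X + w := by
  have hM0 : (0 : ℝ) < M := by exact_mod_cast hM
  have ht : 0 ≤ treeLen X := treeLen_nonneg X
  exact geom_letters (S := {u : Pt d | cubeOf M u ∈ X}) (Δ := (M : ℝ) * (treeLen X + 3)) hx₀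
    (fun _ hu _ hv => B12Decay510Lattice.dist_le_treeLen_sites hM hX hc hu hv) hδ₀ hw (by positivity) ht
    (by nlinarith [mul_nonneg hM0.le ht]) p q

/-- The sup-sharp decay letter is a genuine decay of print's size, d-free: `0 < δ₁ ≤ w/(6·M)` for `0 < δ₀`, `0 < w`, `0 < M`.
[cite: Balaban1987RG1, (4.22) p.286] -/
theorem delta1_lattice_sup_pos_le (hM : 0 < M) {δ₀ w : ℝ} (hδ₀ : 0 < δ₀) (hw : 0 < w) :
    0 < min (δ₀ / 2) (w / (2 * (3 * (M : ℝ)))) ∧ min (δ₀ / 2) (w / (2 * (3 * (M : ℝ)))) ≤ w / (6 * (M : ℝ)) := by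
  have hM0 : (0 : ℝ) < M := by exact_mod_cast hM
  refine ⟨lt_min (by linarith) (div_pos hw (by positivity)), (min_le_right _ _).trans (le_of_eq ?_)⟩
  ring

/-- The sup-sharp letter DOMINATES the ℓ¹ letter of §2: `min (δ₀/2) (w/(2·(3·M·d))) ≤ min (δ₀/2) (w/(2·(3·M)))` for `w ≥ 0`, `0 < M`,
`1 ≤ d` (so every consumer of `geom_lattice` may switch to `geom_lattice_sup` with a larger or equal decay rate). [folklore] -/
theorem delta1_l1_le_delta1_sup (hM : 0 < M) (hd : 0 < d) {δ₀ w : ℝ} (hw : 0 ≤ w) :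
    min (δ₀ / 2) (w / (2 * (3 * (M : ℝ) * d))) ≤ min (δ₀ / 2) (w / (2 * (3 * (M : ℝ)))) := by
  have hM0 : (0 : ℝ) < M := by exact_mod_cast hM
  have hd1 : (1 : ℝ) ≤ d := by exact_mod_cast hd
  refine min_le_min le_rfl (div_le_div_of_nonneg_left hw (by positivity) ?_)
  nlinarith

end Summit.QuantumFields.BalabanUV.T4Continuum.NE9KernelGeometryLattice

end
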